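import Literature.NumberTheory.LFunctions.MellinTruncatedInversion
import Literature.NumberTheory.LFunctions.BondarenkoHeap2026Section6Weights
import Literature.NumberTheory.LFunctions.SmoothDyadicPartition
import Mathlib.Analysis.SpecialFunctions.JapaneseBracket
import Mathlib.Analysis.SpecialFunctions.ImproperIntegrals
import HarnessLib

/-!
# Mellin-separated weights `x ↦ ω(x/X)(X/x)^s`: truncated inversion in hypothesis form and the
# derivative bounds of the separated weight

Topic `Literature/NumberTheory/LFunctions`; a PROVED, source-independent tool file (layers (L1a′) and
(L1c) of the cell memo `MEMO-t3-offDiagReduction.md` for [BondarenkoHeap2026, §6.2], companion of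
`MellinTruncatedInversion.lean`). Bondarenko–Heap separate the variables of a smooth function of
`k, m, r` by a triple inverse Mellin transform truncated at height `H = q^ε` and then use, for each
`s = c + it` with `|t| ≤ H`, the weights `x ↦ ω(x/X)(X/x)^{s}` on `[X, 2X]`: "the resultant weights
after interchanging summation and integration have derivatives bounded by `q^ε` — e.g.
differentiating `(K/x)^{s₁}` with respect to `x` gives a factor of `−s₁` which is then `≪ q^ε`"
(TeX l.808–811). This file supplies:

**Part A (truncated inversion, decay as a hypothesis).** For `V : ℝ → ℂ` continuous (resp.
smooth) with `V x ≠ 0 ⇒ 1 ≤ x ≤ 2`: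
* `MellinSeparated.differentiable_mellin_of_support` — `𝓜V` is entire ("`𝓕̃₀` is an entire
  function", l.800);
* `MellinSeparated.integrable_vertical_of_decay`, `….eq_smul_integral_mellin` — on ANY line
  `Re s = c`, a decay hypothesis `‖𝓜V(c+it)‖ ≤ D(1+|t|)^{−r}` (`r > 1`) gives integrability, and
  integrability gives Mellin inversion `V(x) = (1/2π)∫_ℝ 𝓜V(c+it) x^{−(c+it)} dt`
  [cite: Titchmarsh1948, §1.29] (the sibling file's `MellinTruncated.eq_mellinInv` is the case
  `c > 0` with the decay derived from `‖V''‖`);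
* `MellinSeparated.mellin_truncated_inversion` — **truncated inversion with an explicit tail in
  hypothesis form**: `‖V(x) − (1/2π)∫_{−H}^{H} 𝓜V(c+it)x^{−(c+it)}dt‖ ≤ x^{−c}·2D/((j−1)H^{j−1})`
  for `H ≥ 1`, `j ≥ 2`, the memo's frozen (L1b) signature;
* `MellinSeparated.decay_of_le_div_prod` — the bookkeeping turning the `j`-fold
  integration-by-parts bound `‖𝓜V(c+it)‖ ≤ M/∏_{i<j}‖c+it+i‖` (the tree's
  `BondarenkoHeap2026.PrimeSums.norm_mellin_le_of_iteratedDeriv`) into that decay hypothesis,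
  `D = M/(min(c,1)/2)^j` (`c > 0`).

**Part B (L1c, the separated weight).** For `ω : ℝ → ℂ` smooth with `ω y ≠ 0 ⇒ 1 ≤ y ≤ 2` and a
derivative family `‖ω^{(i)}‖_∞ ≤ B_i`, `s ∈ ℂ` with `Re s ≥ 0` and a scale `X > 0`, the weight
`a(x) = ω(x/X)·(x/X)^{−s}` (`= ω(x/X)(X/x)^{s}` for `x > 0`, `MellinSeparated.kernel_eq`) is smooth
(`contDiff_separatedWeight`), lives on `[X, 2X]` (`separatedWeight_ne_zero_imp`), is bounded by `B₀`
(`norm_separatedWeight_le`) and — the point — has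
`‖a^{(n)}(x)‖ ≤ (n+1)^n (Σ_{i≤n} C(n,i) B_i) · (1+‖s‖)^n / X^n` for EVERY `n`
(`norm_iteratedDeriv_separatedWeight_le`): loss `(1+‖s‖)^n` at order `n` (`≍ q^{nε}` at height
`q^ε` — the reading recorded in the cell's typing note E-ah-3), via the explicit formula
`((y^{−s})^{(m)} = (∏_{l<m}(−s−l)) y^{−s−m}` on `y > 0` (`iteratedDeriv_cpow_neg`) and Leibniz.

**Part C (membership in the corrected weight class).** `isSmoothDyadicWeight'_separatedWeight`:
with `B₀ ≤ 1` the separated weight belongs to `BondarenkoHeap2026.IsSmoothDyadicWeight' X A (1+‖s‖)`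
(the E-ah-3-corrected class of `BondarenkoHeap2026Section6Weights`, loss `Q^j` at order `j`) with
the `s`-, `X`- and `q`-independent family `A n = (n+1)^n Σ_{i≤n} C(n,i) B_i`; and
`exists_isSmoothDyadicWeight'_bump`: for the constructed partition bump `ω` of
`SmoothDyadicPartition` ONE family `A` serves all `s` with `Re s ≥ 0` and all scales `X > 0`.

No definitions, no named facts. NOT RH-BEARING (cell label): generic calculus / complex analysis;
nothing here bears on the truth of RH.

## References

* [Titchmarsh1948] E. C. Titchmarsh, *Introduction to the Theory of Fourier Integrals*, §1.29.
* [BondarenkoHeap2026] A. Bondarenko, W. Heap, arXiv:2608.07399v1, §6.2 (TeX l.795–836).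
-/

noncomputable section

open Real Complex MeasureTheory Set Filter Asymptotics intervalIntegral
open scoped Topology ContDiff

namespace Literature.NumberTheory.LFunctions

namespace MellinSeparated

open MellinTruncated (mellinConvergent_of_support continuous_mellin_vertical)

variable {V : ℝ → ℂ}

/-! ### Part A: Mellin inversion and its truncation, decay as a hypothesis -/

/-- A weight supported in `[1,2]` vanishes off `[1,2]`. [folklore] -/
private theorem eq_zero_of_not_mem (hsupp : ∀ x : ℝ, V x ≠ 0 → 1 ≤ x ∧ x ≤ 2) {x : ℝ}
    (hx : x ∉ Set.Icc (1 : ℝ) 2) : V x = 0 := by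
  by_contra h
  exact hx (hsupp x h)

/-- A weight supported in `[1,2]` is `O(x^{−a})` at `+∞` (it is eventually `0`). [folklore] -/
private theorem isBigO_atTop_of_support (hsupp : ∀ x : ℝ, V x ≠ 0 → 1 ≤ x ∧ x ≤ 2) (a : ℝ) :
    V =O[atTop] fun x : ℝ ↦ x ^ (-a) := by
  have hev : V =ᶠ[atTop] fun _ ↦ (0 : ℂ) := by
    filter_upwards [eventually_gt_atTop (2 : ℝ)] with x hx
    exact eq_zero_of_not_mem hsupp fun h ↦ absurd h.2 (not_le.2 hx)
  exact (isBigO_zero _ _).congr' hev.symm EventuallyEq.rfl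

/-- A weight supported in `[1,2]` is `O(x^{−b})` at `0⁺` (it vanishes on `(0,1)`). [folklore] -/
private theorem isBigO_nhdsGT_of_support (hsupp : ∀ x : ℝ, V x ≠ 0 → 1 ≤ x ∧ x ≤ 2) (b : ℝ) :
    V =O[𝓝[>] 0] fun x : ℝ ↦ x ^ (-b) := by
  have hev : V =ᶠ[𝓝[>] 0] fun _ ↦ (0 : ℂ) := by
    have hmem : Set.Iio (1 : ℝ) ∈ 𝓝[>] (0 : ℝ) :=
      mem_nhdsWithin_of_mem_nhds (Iio_mem_nhds one_pos)
    filter_upwards [hmem] with x hx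
    exact eq_zero_of_not_mem hsupp fun h ↦ absurd h.1 (not_le.2 hx)
  exact (isBigO_zero _ _).congr' hev.symm EventuallyEq.rfl

/-- The Mellin transform of a continuous weight supported in `[1,2]` is entire.
[cite: BondarenkoHeap2026, §6.2 p. 17 (TeX l.800, "𝓕̃₀ is an entire function")] -/
theorem differentiable_mellin_of_support (hc : Continuous V)
    (hsupp : ∀ x : ℝ, V x ≠ 0 → 1 ≤ x ∧ x ≤ 2) : Differentiable ℂ (mellin V) := fun s ↦
  mellin_differentiableAt_of_isBigO_rpow (a := s.re + 1) (b := s.re - 1)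
    (hc.continuousOn.locallyIntegrableOn measurableSet_Ioi) (isBigO_atTop_of_support hsupp _)
    (by linarith) (isBigO_nhdsGT_of_support hsupp _) (by linarith)

/-- `t ↦ (1 + |t|)^{−r}` is integrable on `ℝ` for `r > 1`. [folklore] -/
private theorem integrable_one_add_abs_rpow {r : ℝ} (hr : 1 < r) :
    Integrable fun t : ℝ ↦ (1 + |t|) ^ (-r) := by
  have h := integrable_one_add_norm (E := ℝ) (μ := volume) (r := r) (by simpa using hr)
  simpa [Real.norm_eq_abs] using h

/-- **Vertical integrability from decay**: if `‖𝓜V(c+it)‖ ≤ D (1+|t|)^{−r}` with `r > 1`, then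
`t ↦ 𝓜V(c+it)` is integrable, on any line `Re s = c` ("`𝓕` is given by an absolutely convergent
integral", l.805). [cite: BondarenkoHeap2026, §6.2 p. 17 (TeX l.803–805)] -/
theorem integrable_vertical_of_decay (hc : Continuous V)
    (hsupp : ∀ x : ℝ, V x ≠ 0 → 1 ≤ x ∧ x ≤ 2) {c r D : ℝ} (hr : 1 < r)
    (hD : ∀ t : ℝ, ‖mellin V (c + t * I)‖ ≤ D * (1 + |t|) ^ (-r)) :
    Integrable fun t : ℝ ↦ mellin V (c + t * I) :=
  Integrable.mono' ((integrable_one_add_abs_rpow hr).const_mul D)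
    (continuous_mellin_vertical hc hsupp c).aestronglyMeasurable (Eventually.of_forall hD)

/-- **Mellin inversion on the line `Re s = c`** (any real `c`) for a continuous weight supported in
`[1,2]` whose transform is integrable on that line: `V(x) = (1/2π) ∫_ℝ 𝓜V(c+it) x^{−(c+it)} dt`
for `x > 0` (Mathlib's `mellinInv_mellin_eq`). [cite: Titchmarsh1948, §1.29] -/
theorem eq_smul_integral_mellin (hc : Continuous V) (hsupp : ∀ x : ℝ, V x ≠ 0 → 1 ≤ x ∧ x ≤ 2)
    {c : ℝ} (hint : Integrable fun t : ℝ ↦ mellin V (c + t * I)) {x : ℝ} (hx : 0 < x) :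
    V x = (1 / (2 * π)) • ∫ t : ℝ, mellin V (c + t * I) * (x : ℂ) ^ (-(c + t * I)) := by
  have h := mellinInv_mellin_eq c V hx (mellinConvergent_of_support hc hsupp c) hint hc.continuousAt
  rw [← h, mellinInv]
  congr 1
  refine integral_congr_ae (Eventually.of_forall fun t ↦ ?_)
  simp only [smul_eq_mul, mul_comm]

/-- The two-sided tail `∫_{|t| ≥ H} (1+|t|)^{−r} dt ≤ 2 H^{1−r}/(r−1)` (`r > 1`, `H ≥ 1`). [folklore] -/
private theorem tail_integral_le {r : ℝ} (hr : 1 < r) {H : ℝ} (hH : 1 ≤ H) :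
    ∫ t in (Set.Ioc (-H) H)ᶜ, (1 + |t|) ^ (-r) ≤ 2 * (H ^ (1 - r) / (r - 1)) := by
  have hH0 : 0 < H := by linarith
  have hφ : Integrable fun t : ℝ ↦ (1 + |t|) ^ (-r) := integrable_one_add_abs_rpow hr
  have hset : (Set.Ioc (-H) H)ᶜ = Set.Iic (-H) ∪ Set.Ioi H := by
    ext t
    simp only [mem_compl_iff, mem_Ioc, mem_union, mem_Iic, mem_Ioi, not_and_or, not_lt, not_le]
  have hdisj : Disjoint (Set.Iic (-H)) (Set.Ioi H) := by
    rw [Set.disjoint_iff]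
    rintro t ⟨h1, h2⟩
    simp only [mem_Iic] at h1
    simp only [mem_Ioi] at h2
    linarith
  rw [hset, setIntegral_union hdisj measurableSet_Ioi hφ.integrableOn hφ.integrableOn]
  have hleft : ∫ t in Set.Iic (-H), (1 + |t|) ^ (-r) = ∫ t in Set.Ioi H, (1 + |t|) ^ (-r) := by
    have h1 := integral_comp_neg_Iic (-H) (fun t : ℝ ↦ (1 + |t|) ^ (-r))
    simp only [abs_neg, neg_neg] at h1
    exact h1
  have hright : ∫ t in Set.Ioi H, (1 + |t|) ^ (-r) ≤ H ^ (1 - r) / (r - 1) := by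
    have hle : ∫ t in Set.Ioi H, (1 + |t|) ^ (-r) ≤ ∫ t in Set.Ioi H, t ^ (-r) := by
      refine setIntegral_mono_on hφ.integrableOn (integrableOn_Ioi_rpow_of_lt (by linarith) hH0)
        measurableSet_Ioi fun t ht ↦ ?_
      have ht0 : 0 < t := hH0.trans ht
      rw [abs_of_pos ht0]
      exact Real.rpow_le_rpow_of_nonpos ht0 (by linarith) (by linarith)
    rw [integral_Ioi_rpow_of_lt (by linarith : -r < -1) hH0] at hle
    have hr2 : -r + 1 ≠ 0 := by linarith
    have heq : -H ^ (-r + 1) / (-r + 1) = H ^ (1 - r) / (r - 1) := by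
      rw [show -r + 1 = 1 - r by ring] at hr2 ⊢
      have hr1 : r - 1 ≠ 0 := by linarith
      field_simp
      ring
    linarith [heq]
  linarith [hleft, hright]

/-- **Truncated Mellin inversion with an explicit tail (decay as a hypothesis).** For a smooth
weight `V` supported in `[1,2]` whose Mellin transform decays like `‖𝓜V(c+it)‖ ≤ D(1+|t|)^{−j}` on
the line `Re s = c` (`j ≥ 2`; supplied by `j` integrations by parts, see `decay_of_le_div_prod`),
truncating the inversion integral at height `H ≥ 1` costs at most `x^{−c} · 2D/((j−1)H^{j−1})`:
"We then truncate the `s_j` integrals at height `q^ε`. This gives a negligible error … by the rapid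
decay" (TeX l.806–808). [cite: BondarenkoHeap2026, §6.2 p. 17 (TeX l.795–815)] -/
theorem mellin_truncated_inversion {V : ℝ → ℂ} (hV : ContDiff ℝ ∞ V)
    (hsupp : ∀ x, V x ≠ 0 → 1 ≤ x ∧ x ≤ 2) {c : ℝ} {j : ℕ} (hj : 2 ≤ j) {D : ℝ}
    (hD : ∀ t : ℝ, ‖mellin V (c + t * I)‖ ≤ D * (1 + |t|) ^ (-(j : ℝ))) {H : ℝ} (hH : 1 ≤ H)
    {x : ℝ} (hx : 0 < x) :
    ‖V x - (1 / (2 * π)) • ∫ t in -H..H, mellin V (c + t * I) * (x : ℂ) ^ (-(c + t * I))‖ ≤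
      x ^ (-c) * (2 * D / (((j : ℝ) - 1) * H ^ (j - 1))) := by
  have hc' : Continuous V := hV.continuous
  have hr : (1 : ℝ) < j := by exact_mod_cast lt_of_lt_of_le one_lt_two hj
  have hH0 : 0 < H := by linarith
  set g : ℝ → ℂ := fun t ↦ mellin V (c + t * I) * (x : ℂ) ^ (-((c : ℂ) + t * I)) with hg
  have hker : ∀ t : ℝ, ‖(x : ℂ) ^ (-((c : ℂ) + t * I))‖ = x ^ (-c) := by
    intro t
    rw [Complex.norm_cpow_eq_rpow_re_of_pos hx]
    congr 1
    simp
  have hD0 : 0 ≤ D := by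
    have h := hD 0
    have hpos : (0 : ℝ) < (1 + |(0 : ℝ)|) ^ (-(j : ℝ)) := Real.rpow_pos_of_pos (by norm_num) _
    nlinarith [norm_nonneg (mellin V (c + (0 : ℝ) * I))]
  have hxc : 0 ≤ x ^ (-c) := Real.rpow_nonneg hx.le _
  have hgb : ∀ t, ‖g t‖ ≤ D * x ^ (-c) * (1 + |t|) ^ (-(j : ℝ)) := by
    intro t
    simp only [hg]
    rw [norm_mul, hker]
    calc ‖mellin V (c + t * I)‖ * x ^ (-c) ≤ D * (1 + |t|) ^ (-(j : ℝ)) * x ^ (-c) := by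
          gcongr; exact hD t
      _ = D * x ^ (-c) * (1 + |t|) ^ (-(j : ℝ)) := by ring
  have hφ : Integrable fun t : ℝ ↦ D * x ^ (-c) * (1 + |t|) ^ (-(j : ℝ)) :=
    (integrable_one_add_abs_rpow hr).const_mul _
  have hgc : Continuous g := by
    refine (continuous_mellin_vertical hc' hsupp c).mul ?_
    exact Continuous.const_cpow (by fun_prop) (Or.inl (by exact_mod_cast hx.ne'))
  have hgi : Integrable g := Integrable.mono' hφ hgc.aestronglyMeasurable (Eventually.of_forall hgb)
  have hint : Integrable fun t : ℝ ↦ mellin V (c + t * I) :=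
    integrable_vertical_of_decay hc' hsupp hr hD
  have hinv : V x = (1 / (2 * π)) • ∫ t : ℝ, g t := eq_smul_integral_mellin hc' hsupp hint hx
  have hsplit := integral_add_compl (measurableSet_Ioc : MeasurableSet (Set.Ioc (-H) H)) hgi
  rw [intervalIntegral.integral_of_le (by linarith : -H ≤ H)]
  have hdiff : V x - (1 / (2 * π)) • ∫ t in Set.Ioc (-H) H, g t =
      (1 / (2 * π)) • ∫ t in (Set.Ioc (-H) H)ᶜ, g t := by
    rw [hinv, ← hsplit, smul_add, add_sub_cancel_left]
  rw [hdiff, norm_smul, Real.norm_eq_abs, abs_of_pos (by positivity : (0 : ℝ) < 1 / (2 * π))]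
  have htail : ‖∫ t in (Set.Ioc (-H) H)ᶜ, g t‖ ≤
      D * x ^ (-c) * (2 * (H ^ (1 - (j : ℝ)) / ((j : ℝ) - 1))) := by
    calc ‖∫ t in (Set.Ioc (-H) H)ᶜ, g t‖
        ≤ ∫ t in (Set.Ioc (-H) H)ᶜ, D * x ^ (-c) * (1 + |t|) ^ (-(j : ℝ)) :=
          norm_integral_le_of_norm_le hφ.integrableOn (Eventually.of_forall hgb)
      _ = D * x ^ (-c) * ∫ t in (Set.Ioc (-H) H)ᶜ, (1 + |t|) ^ (-(j : ℝ)) :=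
          integral_const_mul _ _
      _ ≤ D * x ^ (-c) * (2 * (H ^ (1 - (j : ℝ)) / ((j : ℝ) - 1))) := by
          gcongr
          exact tail_integral_le hr hH
  have hHpow : H ^ (1 - (j : ℝ)) = (H ^ (j - 1))⁻¹ := by
    rw [show (1 - (j : ℝ)) = -(((j - 1 : ℕ) : ℝ)) by
      rw [Nat.cast_sub (by omega : 1 ≤ j)]; push_cast; ring,
      Real.rpow_neg hH0.le, Real.rpow_natCast]
  have hj1 : (0 : ℝ) < (j : ℝ) - 1 := by linarith
  have hHj : 0 < H ^ (j - 1) := pow_pos hH0 _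
  have hpi : 1 / (2 * π) ≤ 1 := by
    rw [div_le_iff₀ (by positivity)]
    linarith [Real.two_le_pi]
  calc 1 / (2 * π) * ‖∫ t in (Set.Ioc (-H) H)ᶜ, g t‖
      ≤ 1 / (2 * π) * (D * x ^ (-c) * (2 * (H ^ (1 - (j : ℝ)) / ((j : ℝ) - 1)))) := by
        gcongr
    _ ≤ 1 * (D * x ^ (-c) * (2 * (H ^ (1 - (j : ℝ)) / ((j : ℝ) - 1)))) := by
        gcongr
    _ = x ^ (-c) * (2 * D / (((j : ℝ) - 1) * H ^ (j - 1))) := by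
        rw [hHpow]
        field_simp

/-- On the line `Re w = c > 0`: `∏_{i<j} ‖c + it + i‖ ≥ (min(c,1)/2)^j (1+|t|)^j`. [folklore] -/
private theorem prod_norm_vertical_ge {c : ℝ} (hc : 0 < c) (j : ℕ) (t : ℝ) :
    (min c 1 / 2 * (1 + |t|)) ^ j ≤ ∏ i ∈ Finset.range j, ‖(c : ℂ) + t * I + i‖ := by
  have key : ∀ i ∈ Finset.range j, min c 1 / 2 * (1 + |t|) ≤ ‖(c : ℂ) + t * I + i‖ := by
    intro i _
    have hre : ((c : ℂ) + t * I + i).re = c + i := by simp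
    have him : ((c : ℂ) + t * I + i).im = t := by simp
    have h1 : c + i ≤ ‖(c : ℂ) + t * I + i‖ := by
      have h := Complex.abs_re_le_norm ((c : ℂ) + t * I + i)
      rwa [hre, abs_of_pos (by positivity)] at h
    have h2 : |t| ≤ ‖(c : ℂ) + t * I + i‖ := by
      have h := Complex.abs_im_le_norm ((c : ℂ) + t * I + i)
      rwa [him] at h
    have hmin1 : min c 1 ≤ 1 := min_le_right _ _
    have hminc : min c 1 ≤ c := min_le_left _ _
    have hi0 : (0 : ℝ) ≤ i := Nat.cast_nonneg i
    nlinarith [abs_nonneg t]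
  calc (min c 1 / 2 * (1 + |t|)) ^ j = ∏ _i ∈ Finset.range j, (min c 1 / 2 * (1 + |t|)) := by
        rw [Finset.prod_const, Finset.card_range]
    _ ≤ ∏ i ∈ Finset.range j, ‖(c : ℂ) + t * I + i‖ :=
        Finset.prod_le_prod (fun i _ ↦ by positivity) key

/-- **Decay on a vertical line from the integration-by-parts bound** (L1a′): if
`‖𝓜V(c+it)‖ ≤ M / ∏_{i<j} ‖c + it + i‖` for all `t` (the shape delivered by `j` integrations by
parts, e.g. `BondarenkoHeap2026.PrimeSums.norm_mellin_le_of_iteratedDeriv` at `w = c + it`), with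
`c > 0` and `M ≥ 0`, then `‖𝓜V(c+it)‖ ≤ (M/(min(c,1)/2)^j) · (1+|t|)^{−j}` — the decay hypothesis
of `mellin_truncated_inversion` ("integration by parts shows that `𝓕̃₀(s) ≪_j ∏(1+|t_i|)^{−j}`",
TeX l.800–804). [cite: BondarenkoHeap2026, §6.2 p. 17 (TeX l.800–804)] -/
theorem decay_of_le_div_prod {c : ℝ} (hc : 0 < c) {j : ℕ} {M : ℝ} (hM : 0 ≤ M)
    (h : ∀ t : ℝ, ‖mellin V (c + t * I)‖ ≤ M / ∏ i ∈ Finset.range j, ‖(c : ℂ) + t * I + i‖) :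
    ∀ t : ℝ, ‖mellin V (c + t * I)‖ ≤ M / (min c 1 / 2) ^ j * (1 + |t|) ^ (-(j : ℝ)) := by
  intro t
  have hκ : 0 < min c 1 / 2 := by
    have := lt_min hc one_pos
    positivity
  have hpos : 0 < (min c 1 / 2 * (1 + |t|)) ^ j := by positivity
  calc ‖mellin V (c + t * I)‖ ≤ M / ∏ i ∈ Finset.range j, ‖(c : ℂ) + t * I + i‖ := h t
    _ ≤ M / (min c 1 / 2 * (1 + |t|)) ^ j :=
        div_le_div_of_nonneg_left hM hpos (prod_norm_vertical_ge hc j t)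
    _ = M / (min c 1 / 2) ^ j * (1 + |t|) ^ (-(j : ℝ)) := by
        rw [mul_pow, Real.rpow_neg (by positivity), Real.rpow_natCast]
        field_simp

/-! ### Part B (L1c): the separated weight `x ↦ ω(x/X) (x/X)^{−s}` -/

variable {W : ℝ → ℂ}

/-- For `y > 0`: `y^w = exp(w log y)` (real logarithm). [folklore] -/
private theorem cpow_eq_exp {y : ℝ} (hy : 0 < y) (w : ℂ) :
    ((y : ℝ) : ℂ) ^ w = Complex.exp (w * (Real.log y : ℂ)) := by
  rw [Complex.cpow_def_of_ne_zero (by exact_mod_cast hy.ne'), ← Complex.ofReal_log hy.le, mul_comm]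

/-- **The two spellings of the kernel agree**: `(x/X)^{−s} = (X/x)^{s}` for `x, X > 0` (the paper
writes `(K/k)^{s₁}`, TeX l.797 and l.810). [cite: BondarenkoHeap2026, §6.2 p. 17 (TeX l.795–811)] -/
theorem kernel_eq {x X : ℝ} (hx : 0 < x) (hX : 0 < X) (s : ℂ) :
    (((x / X : ℝ)) : ℂ) ^ (-s) = (((X / x : ℝ)) : ℂ) ^ s := by
  rw [cpow_eq_exp (div_pos hx hX), cpow_eq_exp (div_pos hX hx)]
  congr 1
  have hlog : Real.log (X / x) = -Real.log (x / X) := by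
    rw [← Real.log_inv, inv_div]
  rw [hlog]
  push_cast
  ring

/-- `y ↦ y^w` (real `y`, complex `w`) is smooth at every `y > 0`. [folklore] -/
private theorem contDiffAt_cpow_const {y : ℝ} (hy : 0 < y) (w : ℂ) {n : WithTop ℕ∞} :
    ContDiffAt ℝ n (fun y : ℝ ↦ ((y : ℝ) : ℂ) ^ w) y := by
  have hev : (fun y : ℝ ↦ ((y : ℝ) : ℂ) ^ w) =ᶠ[𝓝 y]
      fun y : ℝ ↦ Complex.exp (w * (Real.log y : ℂ)) := by
    filter_upwards [Ioi_mem_nhds hy] with z hz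
    exact cpow_eq_exp hz w
  refine ContDiffAt.congr_of_eventuallyEq ?_ hev
  have hlog : ContDiffAt ℝ n Real.log y := Real.contDiffAt_log.2 hy.ne'
  have h2 : ContDiffAt ℝ n (fun z : ℝ ↦ ((Real.log z : ℝ) : ℂ)) y :=
    Complex.ofRealCLM.contDiff.comp_contDiffAt y hlog
  exact Complex.contDiff_exp.comp_contDiffAt y (contDiffAt_const.mul h2)

/-- **Iterated derivatives of the kernel**: on `y > 0`,
`(y^{−s})^{(m)} = (∏_{l<m} (−s−l)) · y^{−s−m}` ("differentiating `(K/x)^{s₁}` with respect to `x`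
gives a factor of `−s₁`", TeX l.810). [cite: BondarenkoHeap2026, §6.2 p. 17 (TeX l.808–811)] -/
theorem iteratedDeriv_cpow_neg (s : ℂ) (m : ℕ) :
    Set.EqOn (iteratedDeriv m fun y : ℝ ↦ ((y : ℝ) : ℂ) ^ (-s))
      (fun y : ℝ ↦ (∏ l ∈ Finset.range m, (-s - (l : ℂ))) * ((y : ℝ) : ℂ) ^ (-s - (m : ℂ)))
      (Set.Ioi 0) := by
  induction m with
  | zero =>
    intro y _
    simp
  | succ m ih =>
    intro y hy
    have hy' : (0 : ℝ) < y := hy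
    show iteratedDeriv (m + 1) _ y =
      (∏ l ∈ Finset.range (m + 1), (-s - (l : ℂ))) * ((y : ℝ) : ℂ) ^ (-s - ((m + 1 : ℕ) : ℂ))
    rw [iteratedDeriv_succ]
    have hev : iteratedDeriv m (fun y : ℝ ↦ ((y : ℝ) : ℂ) ^ (-s)) =ᶠ[𝓝 y]
        fun y : ℝ ↦ (∏ l ∈ Finset.range m, (-s - (l : ℂ))) * ((y : ℝ) : ℂ) ^ (-s - (m : ℂ)) := by
      filter_upwards [Ioi_mem_nhds hy'] with z hz
      exact ih hz
    rw [hev.deriv_eq]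
    by_cases hw0 : -s - (m : ℂ) = 0
    · -- the function is constant; the new factor `(-s - m)` vanishes
      have hconst : (fun z : ℝ ↦ (∏ l ∈ Finset.range m, (-s - (l : ℂ))) *
          ((z : ℝ) : ℂ) ^ (-s - (m : ℂ))) = fun _ ↦ ∏ l ∈ Finset.range m, (-s - (l : ℂ)) := by
        funext z
        rw [hw0, Complex.cpow_zero, mul_one]
      rw [hconst, deriv_const, Finset.prod_range_succ, hw0, mul_zero, zero_mul]
    · have hd : HasDerivAt (fun z : ℝ ↦ (∏ l ∈ Finset.range m, (-s - (l : ℂ))) *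
          ((z : ℝ) : ℂ) ^ (-s - (m : ℂ)))
          ((∏ l ∈ Finset.range m, (-s - (l : ℂ))) *
            ((-s - (m : ℂ)) * ((y : ℝ) : ℂ) ^ (-s - (m : ℂ) - 1))) y :=
        (hasDerivAt_ofReal_cpow_const hy'.ne' hw0).const_mul _
      rw [hd.deriv, Finset.prod_range_succ]
      have h1 : -s - (m : ℂ) - 1 = -s - ((m + 1 : ℕ) : ℂ) := by push_cast; ring
      rw [h1]
      push_cast
      ring

/-- `‖∏_{l<m} (−s−l)‖ ≤ (m+1)^m (1+‖s‖)^m`. [folklore] -/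
private theorem norm_prod_range_le (s : ℂ) (m : ℕ) :
    ‖∏ l ∈ Finset.range m, (-s - (l : ℂ))‖ ≤ ((m : ℝ) + 1) ^ m * (1 + ‖s‖) ^ m := by
  rw [norm_prod, ← mul_pow]
  calc ∏ l ∈ Finset.range m, ‖-s - (l : ℂ)‖
      ≤ ∏ _l ∈ Finset.range m, (((m : ℝ) + 1) * (1 + ‖s‖)) :=
        Finset.prod_le_prod (fun _ _ ↦ norm_nonneg _) fun l hl ↦ by
          have hlm : (l : ℝ) ≤ m := by exact_mod_cast (Finset.mem_range.1 hl).le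
          calc ‖-s - (l : ℂ)‖ ≤ ‖-s‖ + ‖(l : ℂ)‖ := norm_sub_le _ _
            _ = ‖s‖ + l := by rw [norm_neg, Complex.norm_natCast]
            _ ≤ ((m : ℝ) + 1) * (1 + ‖s‖) := by nlinarith [norm_nonneg s]
    _ = (((m : ℝ) + 1) * (1 + ‖s‖)) ^ m := by rw [Finset.prod_const, Finset.card_range]

/-- **Size of the kernel derivatives on `y ≥ 1`** (`Re s ≥ 0`):
`‖(y^{−s})^{(m)}‖ ≤ (m+1)^m (1+‖s‖)^m`. [cite: BondarenkoHeap2026, §6.2 p. 17 (TeX l.808–811)] -/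
theorem norm_iteratedDeriv_cpow_neg_le {s : ℂ} (hs : 0 ≤ s.re) (m : ℕ) {y : ℝ} (hy : 1 ≤ y) :
    ‖iteratedDeriv m (fun y : ℝ ↦ ((y : ℝ) : ℂ) ^ (-s)) y‖ ≤ ((m : ℝ) + 1) ^ m * (1 + ‖s‖) ^ m := by
  have hy0 : 0 < y := by linarith
  rw [iteratedDeriv_cpow_neg s m hy0, norm_mul]
  have h2 : ‖((y : ℝ) : ℂ) ^ (-s - (m : ℂ))‖ ≤ 1 := by
    rw [Complex.norm_cpow_eq_rpow_re_of_pos hy0]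
    refine Real.rpow_le_one_of_one_le_of_nonpos hy ?_
    simp only [sub_re, neg_re, natCast_re]
    linarith
  calc ‖∏ l ∈ Finset.range m, (-s - (l : ℂ))‖ * ‖((y : ℝ) : ℂ) ^ (-s - (m : ℂ))‖
      ≤ ((m : ℝ) + 1) ^ m * (1 + ‖s‖) ^ m * 1 :=
        mul_le_mul (norm_prod_range_le s m) h2 (norm_nonneg _) (by positivity)
    _ = ((m : ℝ) + 1) ^ m * (1 + ‖s‖) ^ m := mul_one _

/-- The unscaled separated weight `y ↦ ω(y) y^{−s}` is smooth on all of `ℝ` (it vanishes near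
every `y < 1`). [cite: BondarenkoHeap2026, §6.2 p. 17 (TeX l.808–811, smooth weights)] -/
theorem contDiff_mul_cpow_neg (hW : ContDiff ℝ ∞ W) (hsupp : ∀ y, W y ≠ 0 → 1 ≤ y ∧ y ≤ 2)
    (s : ℂ) : ContDiff ℝ ∞ fun y : ℝ ↦ W y * ((y : ℝ) : ℂ) ^ (-s) := by
  refine contDiff_iff_contDiffAt.2 fun y ↦ ?_
  rcases lt_or_ge (1 / 2 : ℝ) y with hy | hy
  · exact hW.contDiffAt.mul (contDiffAt_cpow_const (by linarith) _)
  · have hev : (fun y : ℝ ↦ W y * ((y : ℝ) : ℂ) ^ (-s)) =ᶠ[𝓝 y] fun _ ↦ (0 : ℂ) := by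
      filter_upwards [Iio_mem_nhds (show y < 1 by linarith)] with z hz
      have hz0 : W z = 0 := by
        by_contra h
        exact absurd (hsupp z h).1 (not_le.2 hz)
      rw [hz0, zero_mul]
    exact contDiffAt_const.congr_of_eventuallyEq hev

/-- Off `[1,2]` all derivatives of `y ↦ ω(y) y^{−s}` vanish. [folklore] -/
private theorem iteratedDeriv_mul_cpow_neg_eq_zero (hsupp : ∀ y, W y ≠ 0 → 1 ≤ y ∧ y ≤ 2)
    (s : ℂ) (n : ℕ) {y : ℝ} (hy : y < 1 ∨ 2 < y) :
    iteratedDeriv n (fun y : ℝ ↦ W y * ((y : ℝ) : ℂ) ^ (-s)) y = 0 := by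
  have hzero : ∀ z : ℝ, (z < 1 ∨ 2 < z) → W z * ((z : ℝ) : ℂ) ^ (-s) = 0 := by
    intro z hz
    have hz0 : W z = 0 := by
      by_contra h
      rcases hz with hz | hz
      · exact absurd (hsupp z h).1 (not_le.2 hz)
      · exact absurd (hsupp z h).2 (not_le.2 hz)
    rw [hz0, zero_mul]
  have hev : (fun y : ℝ ↦ W y * ((y : ℝ) : ℂ) ^ (-s)) =ᶠ[𝓝 y] fun _ ↦ (0 : ℂ) := by
    rcases hy with hy | hy
    · filter_upwards [Iio_mem_nhds hy] with z hz
      exact hzero z (Or.inl hz)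
    · filter_upwards [Ioi_mem_nhds hy] with z hz
      exact hzero z (Or.inr hz)
  rw [hev.iteratedDeriv_eq n, iteratedDeriv_const]
  split_ifs <;> rfl

/-- **Derivative bounds for the unscaled separated weight**: with `‖ω^{(i)}‖_∞ ≤ B_i` and
`Re s ≥ 0`, `‖(ω · y^{−s})^{(n)}(y)‖ ≤ (n+1)^n (Σ_{i≤n} C(n,i) B_i) (1+‖s‖)^n` for all `y`
(Leibniz on `[1,2]`, zero outside). [cite: BondarenkoHeap2026, §6.2 p. 17 (TeX l.808–811)] -/
theorem norm_iteratedDeriv_mul_cpow_neg_le (hW : ContDiff ℝ ∞ W)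
    (hsupp : ∀ y, W y ≠ 0 → 1 ≤ y ∧ y ≤ 2) {B : ℕ → ℝ}
    (hB : ∀ (i : ℕ) (y : ℝ), ‖iteratedDeriv i W y‖ ≤ B i) {s : ℂ} (hs : 0 ≤ s.re) (n : ℕ)
    (y : ℝ) :
    ‖iteratedDeriv n (fun y : ℝ ↦ W y * ((y : ℝ) : ℂ) ^ (-s)) y‖ ≤
      ((n : ℝ) + 1) ^ n * (∑ i ∈ Finset.range (n + 1), (n.choose i : ℝ) * B i) *
        (1 + ‖s‖) ^ n := by
  have hB0 : ∀ i, 0 ≤ B i := fun i ↦ (norm_nonneg _).trans (hB i 0)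
  have hRHS : 0 ≤ ((n : ℝ) + 1) ^ n * (∑ i ∈ Finset.range (n + 1), (n.choose i : ℝ) * B i) *
      (1 + ‖s‖) ^ n := by
    have : 0 ≤ ∑ i ∈ Finset.range (n + 1), (n.choose i : ℝ) * B i :=
      Finset.sum_nonneg fun i _ ↦ by have := hB0 i; positivity
    positivity
  by_cases hy : 1 ≤ y ∧ y ≤ 2
  · have hy0 : 0 < y := by linarith [hy.1]
    have hmul : (fun y : ℝ ↦ W y * ((y : ℝ) : ℂ) ^ (-s)) =
        W * fun y : ℝ ↦ ((y : ℝ) : ℂ) ^ (-s) := rfl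
    rw [hmul, iteratedDeriv_mul (hW.of_le (by exact_mod_cast le_top)).contDiffAt
      (contDiffAt_cpow_const hy0 _)]
    have hn1 : (1 : ℝ) ≤ (n : ℝ) + 1 := by
      have : (0 : ℝ) ≤ n := Nat.cast_nonneg n
      linarith
    have hs1 : (1 : ℝ) ≤ 1 + ‖s‖ := by
      have := norm_nonneg s
      linarith
    have hterm : ∀ i ∈ Finset.range (n + 1),
        ‖(n.choose i : ℂ) * iteratedDeriv i W y *
            iteratedDeriv (n - i) (fun y : ℝ ↦ ((y : ℝ) : ℂ) ^ (-s)) y‖ ≤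
          (n.choose i : ℝ) * B i * (((n : ℝ) + 1) ^ n * (1 + ‖s‖) ^ n) := by
      intro i _
      rw [norm_mul, norm_mul, Complex.norm_natCast]
      have h1 := hB i y
      have h2 : ‖iteratedDeriv (n - i) (fun y : ℝ ↦ ((y : ℝ) : ℂ) ^ (-s)) y‖ ≤
          ((n : ℝ) + 1) ^ n * (1 + ‖s‖) ^ n := by
        refine (norm_iteratedDeriv_cpow_neg_le hs (n - i) hy.1).trans ?_
        have hk : (((n - i : ℕ) : ℝ) + 1) ≤ (n : ℝ) + 1 := by
          have : ((n - i : ℕ) : ℝ) ≤ n := by exact_mod_cast Nat.sub_le n i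
          linarith
        calc (((n - i : ℕ) : ℝ) + 1) ^ (n - i) * (1 + ‖s‖) ^ (n - i)
            ≤ ((n : ℝ) + 1) ^ (n - i) * (1 + ‖s‖) ^ (n - i) := by
              gcongr
          _ ≤ ((n : ℝ) + 1) ^ n * (1 + ‖s‖) ^ n :=
              mul_le_mul (pow_le_pow_right₀ hn1 (Nat.sub_le n i))
                (pow_le_pow_right₀ hs1 (Nat.sub_le n i)) (by positivity) (by positivity)
      have hc0 : (0 : ℝ) ≤ (n.choose i : ℝ) := Nat.cast_nonneg _
      exact mul_le_mul (mul_le_mul_of_nonneg_left h1 hc0) h2 (norm_nonneg _)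
        (mul_nonneg hc0 (hB0 i))
    calc ‖∑ i ∈ Finset.range (n + 1), (n.choose i : ℂ) * iteratedDeriv i W y *
            iteratedDeriv (n - i) (fun y : ℝ ↦ ((y : ℝ) : ℂ) ^ (-s)) y‖
        ≤ ∑ i ∈ Finset.range (n + 1), ‖(n.choose i : ℂ) * iteratedDeriv i W y *
            iteratedDeriv (n - i) (fun y : ℝ ↦ ((y : ℝ) : ℂ) ^ (-s)) y‖ := norm_sum_le _ _
      _ ≤ ∑ i ∈ Finset.range (n + 1),
            (n.choose i : ℝ) * B i * (((n : ℝ) + 1) ^ n * (1 + ‖s‖) ^ n) :=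
          Finset.sum_le_sum hterm
      _ = ((n : ℝ) + 1) ^ n * (∑ i ∈ Finset.range (n + 1), (n.choose i : ℝ) * B i) *
            (1 + ‖s‖) ^ n := by
          rw [← Finset.sum_mul]
          ring
  · have hy' : y < 1 ∨ 2 < y := by
      rcases not_and_or.1 hy with h | h
      · exact Or.inl (not_le.1 h)
      · exact Or.inr (not_le.1 h)
    rw [iteratedDeriv_mul_cpow_neg_eq_zero hsupp s n hy', norm_zero]
    exact hRHS

/-- **The separated weight `a(x) = ω(x/X)(x/X)^{−s}` is smooth.**
[cite: BondarenkoHeap2026, §6.2 p. 17 (TeX l.808–811, 834–836)] -/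
theorem contDiff_separatedWeight (hW : ContDiff ℝ ∞ W) (hsupp : ∀ y, W y ≠ 0 → 1 ≤ y ∧ y ≤ 2)
    (s : ℂ) (X : ℝ) :
    ContDiff ℝ ∞ fun x : ℝ ↦ W (x / X) * (((x / X : ℝ)) : ℂ) ^ (-s) :=
  (contDiff_mul_cpow_neg hW hsupp s).comp (contDiff_id.div_const X)

/-- **Support**: `a(x) ≠ 0 ⇒ X ≤ x ≤ 2X` (`X > 0`).
[cite: BondarenkoHeap2026, §6.2 p. 17 (TeX l.834–836, "supported on [K,2K]")] -/
theorem separatedWeight_ne_zero_imp (hsupp : ∀ y, W y ≠ 0 → 1 ≤ y ∧ y ≤ 2) (s : ℂ) {X : ℝ}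
    (hX : 0 < X) {x : ℝ} (hx : W (x / X) * (((x / X : ℝ)) : ℂ) ^ (-s) ≠ 0) :
    X ≤ x ∧ x ≤ 2 * X := by
  have hW : W (x / X) ≠ 0 := fun h ↦ hx (by rw [h, zero_mul])
  obtain ⟨h1, h2⟩ := hsupp _ hW
  exact ⟨by rwa [le_div_iff₀ hX, one_mul] at h1, by rwa [div_le_iff₀ hX] at h2⟩

/-- **Sup norm**: `‖a(x)‖ ≤ B₀` (`Re s ≥ 0`; `|(x/X)^{−s}| ≤ 1` on the support).
[cite: BondarenkoHeap2026, §6.2 p. 17 (TeX l.834–836, "1-bounded")] -/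
theorem norm_separatedWeight_le (hsupp : ∀ y, W y ≠ 0 → 1 ≤ y ∧ y ≤ 2) {B : ℕ → ℝ}
    (hB : ∀ (i : ℕ) (y : ℝ), ‖iteratedDeriv i W y‖ ≤ B i) {s : ℂ} (hs : 0 ≤ s.re) (X x : ℝ) :
    ‖W (x / X) * (((x / X : ℝ)) : ℂ) ^ (-s)‖ ≤ B 0 := by
  have hB0 : 0 ≤ B 0 := (norm_nonneg _).trans (hB 0 0)
  by_cases hW : W (x / X) = 0
  · rw [hW, zero_mul, norm_zero]
    exact hB0
  · obtain ⟨h1, _⟩ := hsupp _ hW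
    have hy0 : 0 < x / X := by linarith
    rw [norm_mul]
    have hk : ‖(((x / X : ℝ)) : ℂ) ^ (-s)‖ ≤ 1 := by
      rw [Complex.norm_cpow_eq_rpow_re_of_pos hy0]
      refine Real.rpow_le_one_of_one_le_of_nonpos h1 ?_
      simp only [neg_re]
      linarith
    have hW0 : ‖W (x / X)‖ ≤ B 0 := by simpa using hB 0 (x / X)
    calc ‖W (x / X)‖ * ‖(((x / X : ℝ)) : ℂ) ^ (-s)‖ ≤ B 0 * 1 :=
          mul_le_mul hW0 hk (norm_nonneg _) hB0
      _ = B 0 := mul_one _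

/-- **Derivative bounds for the separated weight** (L1c): with `‖ω^{(i)}‖_∞ ≤ B_i`, `Re s ≥ 0`
and `X > 0`, for every order `n` and every `x`,
`‖a^{(n)}(x)‖ ≤ (n+1)^n (Σ_{i≤n} C(n,i) B_i) · (1+‖s‖)^n / X^n` — loss `(1+‖s‖)^n` at order `n`
("differentiating `(K/x)^{s₁}` … gives a factor of `−s₁` which is then `≪ q^ε`", TeX l.808–811;
the order-`n` loss is `≍ |s|^n`). [cite: BondarenkoHeap2026, §6.2 p. 17 (TeX l.808–811, 834–836)] -/
theorem norm_iteratedDeriv_separatedWeight_le (hW : ContDiff ℝ ∞ W)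
    (hsupp : ∀ y, W y ≠ 0 → 1 ≤ y ∧ y ≤ 2) {B : ℕ → ℝ}
    (hB : ∀ (i : ℕ) (y : ℝ), ‖iteratedDeriv i W y‖ ≤ B i) {s : ℂ} (hs : 0 ≤ s.re) {X : ℝ}
    (hX : 0 < X) (n : ℕ) (x : ℝ) :
    ‖iteratedDeriv n (fun x : ℝ ↦ W (x / X) * (((x / X : ℝ)) : ℂ) ^ (-s)) x‖ ≤
      ((n : ℝ) + 1) ^ n * (∑ i ∈ Finset.range (n + 1), (n.choose i : ℝ) * B i) *
        (1 + ‖s‖) ^ n / X ^ n := by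
  set φ : ℝ → ℂ := fun y ↦ W y * ((y : ℝ) : ℂ) ^ (-s) with hφ
  have hcomp : (fun x : ℝ ↦ W (x / X) * (((x / X : ℝ)) : ℂ) ^ (-s)) = fun x ↦ φ (X⁻¹ * x) := by
    funext x
    simp only [hφ, div_eq_inv_mul]
  have hφn : ContDiff ℝ n φ := (contDiff_mul_cpow_neg hW hsupp s).of_le (by exact_mod_cast le_top)
  rw [hcomp, iteratedDeriv_comp_const_smul hφn X⁻¹]
  dsimp only
  rw [norm_smul, norm_pow, norm_inv, Real.norm_eq_abs, abs_of_pos hX, inv_pow,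
    ← div_eq_inv_mul]
  gcongr
  exact norm_iteratedDeriv_mul_cpow_neg_le hW hsupp hB hs n (X⁻¹ * x)


/-! ### Part C: membership in the corrected weight class `IsSmoothDyadicWeight'` -/

open BondarenkoHeap2026 (IsSmoothDyadicWeight')
open SmoothDyadicPartition (bump bump_nonneg bump_le_one bump_ne_zero_imp bump_contDiff_ofReal
  exists_bound_iteratedDeriv_bump_ofReal)

/-- **The separated weight lies in the corrected class**: with `‖ω^{(i)}‖_∞ ≤ B_i`, `B₀ ≤ 1`,
`Re s ≥ 0`, `X > 0`, the weight `x ↦ ω(x/X)(x/X)^{−s}` is an `IsSmoothDyadicWeight' X A (1+‖s‖)`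
with `A n = (n+1)^n Σ_{i≤n} C(n,i) B_i` — loss `(1+‖s‖)^j` at order `j`, the reading of "whose
`j`th order derivatives are `≪ q^ε`" (TeX l.834–836) recorded in the cell's typing note E-ah-3.
[cite: BondarenkoHeap2026, §6.2 p. 17 (TeX l.808–811, 834–836)] -/
theorem isSmoothDyadicWeight'_separatedWeight (hW : ContDiff ℝ ∞ W)
    (hsupp : ∀ y, W y ≠ 0 → 1 ≤ y ∧ y ≤ 2) {B : ℕ → ℝ}
    (hB : ∀ (i : ℕ) (y : ℝ), ‖iteratedDeriv i W y‖ ≤ B i) (hB1 : B 0 ≤ 1) {s : ℂ}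
    (hs : 0 ≤ s.re) {X : ℝ} (hX : 0 < X) :
    IsSmoothDyadicWeight' X
      (fun n ↦ ((n : ℝ) + 1) ^ n * ∑ i ∈ Finset.range (n + 1), (n.choose i : ℝ) * B i)
      (1 + ‖s‖) (fun x : ℝ ↦ W (x / X) * (((x / X : ℝ)) : ℂ) ^ (-s)) :=
  ⟨contDiff_separatedWeight hW hsupp s X, fun _ hx ↦ separatedWeight_ne_zero_imp hsupp s hX hx,
    fun x ↦ (norm_separatedWeight_le hsupp hB hs X x).trans hB1,
    fun n x ↦ norm_iteratedDeriv_separatedWeight_le hW hsupp hB hs hX n x⟩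

/-- **One derivative family for all the Mellin-separated bump weights**: for the constructed
partition bump `ω` of `SmoothDyadicPartition` there is a family `A` (independent of `s`, `X` and
`q`) such that `x ↦ ω(x/X)(x/X)^{−s}` is an `IsSmoothDyadicWeight' X A (1+‖s‖)` for every `s` with
`Re s ≥ 0` and every scale `X > 0` — the quantifier order `∀ A ∃ ε₁` of `CorrSumBoundOn'` can thus
be served with this single `A`, the height of the truncation entering only through `Q = 1+‖s‖`.
[cite: BondarenkoHeap2026, §6.2 p. 17 (TeX l.808–811, 834–836)] -/
theorem exists_isSmoothDyadicWeight'_bump :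
    ∃ A : ℕ → ℝ, ∀ (s : ℂ), 0 ≤ s.re → ∀ (X : ℝ), 0 < X →
      IsSmoothDyadicWeight' X A (1 + ‖s‖)
        (fun x : ℝ ↦ (bump (x / X) : ℂ) * (((x / X : ℝ)) : ℂ) ^ (-s)) := by
  have hex : ∀ j : ℕ, ∃ C : ℝ, 0 ≤ C ∧
      ∀ x : ℝ, ‖iteratedDeriv j (fun y : ℝ ↦ (bump y : ℂ)) x‖ ≤ C :=
    exists_bound_iteratedDeriv_bump_ofReal
  choose C hC0 hC using hex
  set B : ℕ → ℝ := fun j ↦ if j = 0 then 1 else C j with hBdef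
  have hB0 : B 0 = 1 := by simp [hBdef]
  have hB : ∀ (i : ℕ) (y : ℝ), ‖iteratedDeriv i (fun y : ℝ ↦ (bump y : ℂ)) y‖ ≤ B i := by
    intro i y
    by_cases hi : i = 0
    · subst hi
      rw [hB0, iteratedDeriv_zero, Complex.norm_real, Real.norm_eq_abs,
        abs_of_nonneg (bump_nonneg y)]
      exact bump_le_one y
    · have hBi : B i = C i := by simp [hBdef, hi]
      rw [hBi]
      exact hC i y
  have hsupp : ∀ y : ℝ, (bump y : ℂ) ≠ 0 → 1 ≤ y ∧ y ≤ 2 := fun y hy ↦ by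
    have h := bump_ne_zero_imp (x := y) fun h0 ↦ hy (by rw [h0, Complex.ofReal_zero])
    exact ⟨h.1.le, h.2.le⟩
  refine ⟨fun n ↦ ((n : ℝ) + 1) ^ n * ∑ i ∈ Finset.range (n + 1), (n.choose i : ℝ) * B i,
    fun s hs X hX ↦ ?_⟩
  exact isSmoothDyadicWeight'_separatedWeight bump_contDiff_ofReal hsupp hB hB0.le hs hX

end MellinSeparated

end Literature.NumberTheory.LFunctions

end
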